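import Summits.KontsevichZagierPeriods.KontsevichZagierPeriods.Theorems.SoloInformedParamCoin
import Summits.KontsevichZagierPeriods.KontsevichZagierPeriods.Theorems.SoloInformedTameMapFamilies
import HarnessLib

/-!
# Admissibility of a parametrised term is `ℚ`-semialgebraic in the parameter

For a parametrised term `T : SoloInformedPTerm K d` the sets of parameters `p` at which `T` is
functional, bounded, admissible are `ℚ`-semialgebraic (`isSemialgebraic_setOf_functional`,
`…_bounded`, `…_adm`), as is `{p | T.fibre p = T'.fibre p}`. The proofs put each predicate in
block form (quantifier blocks over `ℝ^m`, atoms `u ∘ σ ∈ S` for re-indexings `σ`) and apply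
Tarski–Seidenberg projection (`soloInformed_isSemialgebraic_setOf_forall_block` / `exists_block`).
The re-indexing `soloSnocIdx` realises `Fin.snoc x (w i)` inside a block `((p, x), w)`.

References: [cite: BochnakCosteRoy1998, Prop. 2.2.4, Thm. 2.2.1];
[cite: KontsevichZagier2001, §1.1].
-/

noncomputable section

open Set MeasureTheory MvPolynomial Literature.ModelTheory.ExponentialFields
  Literature.NumberTheory.Transcendental

namespace Summit.KontsevichZagierPeriods.KontsevichZagierPeriods.Theorems

/-- `{u | |u a| ≤ u b}` is `ℚ`-semialgebraic. [cite: BochnakCosteRoy1998, Def. 2.1.4] -/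
theorem soloInformed_isSemialgebraic_setOf_abs_coord_le {ι : Type*} (a b : ι) :
    IsSemialgebraic ℚ {u : ι → ℝ | |u a| ≤ u b} := by
  have hset : {u : ι → ℝ | |u a| ≤ u b} =
      {u | aeval u (-(X b) : MvPolynomial ι ℚ) ≤ aeval u (X a : MvPolynomial ι ℚ)} ∩
      {u | aeval u (X a : MvPolynomial ι ℚ) ≤ aeval u (X b : MvPolynomial ι ℚ)} := by
    ext u
    simp only [mem_setOf_eq, mem_inter_iff, map_neg, aeval_X, abs_le]
  rw [hset]
  exact (isSemialgebraic_setOf_eval_le _ _).inter (isSemialgebraic_setOf_eval_le _ _)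

/-- `{u | u a = u b + u c}` is `ℚ`-semialgebraic. [cite: BochnakCosteRoy1998, Def. 2.1.4] -/
theorem soloInformed_isSemialgebraic_setOf_coord_eq_add {ι : Type*} (a b c : ι) :
    IsSemialgebraic ℚ {u : ι → ℝ | u a = u b + u c} := by
  have hset : {u : ι → ℝ | u a = u b + u c} =
      {u | aeval u (X a - X b - X c : MvPolynomial ι ℚ) = 0} := by
    ext u
    simp only [mem_setOf_eq, map_sub, aeval_X]
    constructor <;> intro h' <;> linarith
  rw [hset]
  exact isSemialgebraic_setOf_eval_eq_zero _

namespace SoloInformedPTerm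

variable {K : Type} {d : ℕ}

/-- The re-indexing realising `Fin.snoc x (w i)` inside the block `((p, x), w)`.
[cite: BochnakCosteRoy1998, Prop. 2.2.4] -/
def soloSnocIdx (K : Type) (d m : ℕ) (i : Fin m) : K ⊕ Fin (d + 1) → (K ⊕ Fin d) ⊕ Fin m :=
  Sum.elim (fun k => Sum.inl (Sum.inl k)) (Fin.snoc (fun j => Sum.inl (Sum.inr j)) (Sum.inr i))

/-- What `soloSnocIdx` does. [cite: BochnakCosteRoy1998, Prop. 2.2.4] -/
theorem sumElim_comp_snocIdx {m : ℕ} (p : K → ℝ) (x : Fin d → ℝ) (w : Fin m → ℝ) (i : Fin m) :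
    Sum.elim (Sum.elim p x) w ∘ soloSnocIdx K d m i = Sum.elim p (Fin.snoc x (w i)) := by
  simp only [soloSnocIdx, Sum.comp_elim, Fin.comp_snoc]
  rfl

/-- Membership form of `sumElim_comp_snocIdx`. [cite: BochnakCosteRoy1998, Prop. 2.2.4] -/
theorem comp_snocIdx_mem_iff {m : ℕ} (T : SoloInformedPTerm K d) (p : K → ℝ) (x : Fin d → ℝ)
    (w : Fin m → ℝ) (i : Fin m) :
    Sum.elim (Sum.elim p x) w ∘ soloSnocIdx K d m i ∈ T.G ↔ Fin.snoc x (w i) ∈ T.gfibre p := by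
  rw [sumElim_comp_snocIdx]
  rfl

/-! ### Functionality -/

/-- Block form of functionality. [cite: BochnakCosteRoy1998, Def. 2.2.5] -/
theorem functional_iff_block (T : SoloInformedPTerm K d) (p : K → ℝ) :
    T.SoloInformedFunctional p ↔ ∀ x : Fin d → ℝ, x ∈ T.fibre p →
      (∃ t : Fin 1 → ℝ, Fin.snoc x (t 0) ∈ T.gfibre p) ∧
      ∀ w : Fin 2 → ℝ, Fin.snoc x (w 0) ∈ T.gfibre p → Fin.snoc x (w 1) ∈ T.gfibre p →
        w 0 = w 1 := by
  refine forall₂_congr fun x _ => and_congr ?_ ?_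
  · exact ⟨fun ⟨t, ht⟩ => ⟨fun _ => t, ht⟩, fun ⟨t, ht⟩ => ⟨t 0, ht⟩⟩
  · refine ⟨fun h w h0 h1 => h _ _ h0 h1, fun h t t' ht ht' => ?_⟩
    have := h ![t, t'] (by simpa using ht) (by simpa using ht')
    simpa using this

/-- **`{p | T is functional at p}` is `ℚ`-semialgebraic.**
[cite: BochnakCosteRoy1998, Prop. 2.2.4] -/
theorem isSemialgebraic_setOf_functional [Finite K] (T : SoloInformedPTerm K d) :
    IsSemialgebraic ℚ {p : K → ℝ | T.SoloInformedFunctional p} := by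
  have hE : IsSemialgebraic ℚ {u : (K ⊕ Fin d) ⊕ Fin 1 → ℝ | u ∘ soloSnocIdx K d 1 0 ∈ T.G} :=
    T.hG.preimage_comp _
  have hU : IsSemialgebraic ℚ {u : (K ⊕ Fin d) ⊕ Fin 2 → ℝ |
      u ∘ soloSnocIdx K d 2 0 ∈ T.G → u ∘ soloSnocIdx K d 2 1 ∈ T.G →
        u (Sum.inr 0) = u (Sum.inr 1)} :=
    soloInformed_isSemialgebraic_setOf_imp (T.hG.preimage_comp _)
      (soloInformed_isSemialgebraic_setOf_imp (T.hG.preimage_comp _)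
        (soloInformed_isSemialgebraic_setOf_coord_eq _ _))
  have hA : IsSemialgebraic ℚ {v : K ⊕ Fin d → ℝ | v ∈ T.S →
      (∃ t : Fin 1 → ℝ, Sum.elim v t ∈ {u | u ∘ soloSnocIdx K d 1 0 ∈ T.G}) ∧
      ∀ w : Fin 2 → ℝ, Sum.elim v w ∈ {u : (K ⊕ Fin d) ⊕ Fin 2 → ℝ |
        u ∘ soloSnocIdx K d 2 0 ∈ T.G → u ∘ soloSnocIdx K d 2 1 ∈ T.G →
          u (Sum.inr 0) = u (Sum.inr 1)}} :=
    soloInformed_isSemialgebraic_setOf_imp T.hS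
      (soloInformed_isSemialgebraic_setOf_and
        (soloInformed_isSemialgebraic_setOf_exists_block hE fun _ => Iff.rfl)
        (soloInformed_isSemialgebraic_setOf_forall_block hU fun _ => Iff.rfl))
  have hset : {p : K → ℝ | T.SoloInformedFunctional p} = {p | ∀ x : Fin d → ℝ, x ∈ T.fibre p →
      (∃ t : Fin 1 → ℝ, Fin.snoc x (t 0) ∈ T.gfibre p) ∧
      ∀ w : Fin 2 → ℝ, Fin.snoc x (w 0) ∈ T.gfibre p → Fin.snoc x (w 1) ∈ T.gfibre p →
        w 0 = w 1} := by
    ext p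
    exact T.functional_iff_block p
  rw [hset]
  refine soloInformed_isSemialgebraic_setOf_forall_fibre hA fun p x => ?_
  simp only [mem_setOf_eq, comp_snocIdx_mem_iff, mem_fibre, Sum.elim_inr]

/-! ### Boundedness and admissibility -/

/-- Block form of boundedness. [cite: KontsevichZagier2001, §1.1] -/
theorem bounded_iff_block (T : SoloInformedPTerm K d) (p : K → ℝ) :
    T.SoloInformedBounded p ↔ ∃ M : Fin 1 → ℝ,
      (∀ x : Fin d → ℝ, x ∈ T.fibre p → ∀ i, |x i| ≤ M 0) ∧
      ∀ (x : Fin d → ℝ) (w : Fin 1 → ℝ), x ∈ T.fibre p → Fin.snoc x (w 0) ∈ T.gfibre p →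
        |w 0| ≤ M 0 := by
  constructor
  · rintro ⟨M, h₁, h₂⟩
    exact ⟨fun _ => M, h₁, fun x w hx hw => h₂ x hx _ hw⟩
  · rintro ⟨M, h₁, h₂⟩
    exact ⟨M 0, h₁, fun x hx t ht => h₂ x (fun _ => t) hx ht⟩

/-- Membership in the domain family of a pullback along `Sum.inl`.
[cite: BochnakCosteRoy1998, Prop. 2.2.4] -/
theorem sumElim_mem_pullback_inl_S_iff {m : ℕ} (T : SoloInformedPTerm K d) (p : K → ℝ)
    (M : Fin m → ℝ) (x : Fin d → ℝ) :
    Sum.elim (Sum.elim p M) x ∈ (T.pullback (Sum.inl : K → K ⊕ Fin m)).S ↔ x ∈ T.fibre p := by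
  rw [← mem_fibre, fibre_pullback, Sum.elim_comp_inl]

/-- Membership in the graph family of a pullback along `Sum.inl`.
[cite: BochnakCosteRoy1998, Prop. 2.2.4] -/
theorem sumElim_mem_pullback_inl_G_iff {m : ℕ} (T : SoloInformedPTerm K d) (p : K → ℝ)
    (M : Fin m → ℝ) (z : Fin (d + 1) → ℝ) :
    Sum.elim (Sum.elim p M) z ∈ (T.pullback (Sum.inl : K → K ⊕ Fin m)).G ↔ z ∈ T.gfibre p := by
  rw [← mem_gfibre, gfibre_pullback, Sum.elim_comp_inl]

/-- **`{p | T is bounded at p}` is `ℚ`-semialgebraic.** [cite: BochnakCosteRoy1998, Prop. 2.2.4] -/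
theorem isSemialgebraic_setOf_bounded [Finite K] (T : SoloInformedPTerm K d) :
    IsSemialgebraic ℚ {p : K → ℝ | T.SoloInformedBounded p} := by
  let T' := T.pullback (Sum.inl : K → K ⊕ Fin 1)
  have hB₁ : IsSemialgebraic ℚ {u : (K ⊕ Fin 1) ⊕ Fin d → ℝ |
      u ∈ T'.S → ∀ i : Fin d, |u (Sum.inr i)| ≤ u (Sum.inl (Sum.inr 0))} :=
    soloInformed_isSemialgebraic_setOf_imp T'.hS
      (soloInformed_isSemialgebraic_setOf_forall fun i =>
        soloInformed_isSemialgebraic_setOf_abs_coord_le _ _)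
  have hB₂ : IsSemialgebraic ℚ {y : ((K ⊕ Fin 1) ⊕ Fin d) ⊕ Fin 1 → ℝ |
      y ∘ Sum.inl ∈ T'.S → y ∘ soloSnocIdx (K ⊕ Fin 1) d 1 0 ∈ T'.G →
        |y (Sum.inr 0)| ≤ y (Sum.inl (Sum.inl (Sum.inr 0)))} :=
    soloInformed_isSemialgebraic_setOf_imp (T'.hS.preimage_comp _)
      (soloInformed_isSemialgebraic_setOf_imp (T'.hG.preimage_comp _)
        (soloInformed_isSemialgebraic_setOf_abs_coord_le _ _))
  have hB : IsSemialgebraic ℚ {v : K ⊕ Fin 1 → ℝ |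
      (∀ x : Fin d → ℝ, Sum.elim v x ∈ {u : (K ⊕ Fin 1) ⊕ Fin d → ℝ |
        u ∈ T'.S → ∀ i : Fin d, |u (Sum.inr i)| ≤ u (Sum.inl (Sum.inr 0))}) ∧
      ∀ x : Fin d → ℝ, Sum.elim v x ∈ {u : (K ⊕ Fin 1) ⊕ Fin d → ℝ | ∀ w : Fin 1 → ℝ,
        Sum.elim u w ∈ {y : ((K ⊕ Fin 1) ⊕ Fin d) ⊕ Fin 1 → ℝ |
          y ∘ Sum.inl ∈ T'.S → y ∘ soloSnocIdx (K ⊕ Fin 1) d 1 0 ∈ T'.G →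
            |y (Sum.inr 0)| ≤ y (Sum.inl (Sum.inl (Sum.inr 0)))}}} :=
    soloInformed_isSemialgebraic_setOf_and
      (soloInformed_isSemialgebraic_setOf_forall_block hB₁ fun _ => Iff.rfl)
      (soloInformed_isSemialgebraic_setOf_forall_block
        (soloInformed_isSemialgebraic_setOf_forall_block hB₂ fun _ => Iff.rfl) fun _ => Iff.rfl)
  have hset : {p : K → ℝ | T.SoloInformedBounded p} = {p | ∃ M : Fin 1 → ℝ,
      (∀ x : Fin d → ℝ, x ∈ T.fibre p → ∀ i, |x i| ≤ M 0) ∧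
      ∀ (x : Fin d → ℝ) (w : Fin 1 → ℝ), x ∈ T.fibre p → Fin.snoc x (w 0) ∈ T.gfibre p →
        |w 0| ≤ M 0} := by
    ext p
    exact T.bounded_iff_block p
  rw [hset]
  refine soloInformed_isSemialgebraic_setOf_exists_block hB fun p => exists_congr fun M => ?_
  simp only [mem_setOf_eq, Sum.elim_comp_inl, comp_snocIdx_mem_iff, sumElim_mem_pullback_inl_S_iff,
    gfibre_pullback, mem_gfibre, Sum.elim_inl, Sum.elim_inr, T']

/-- **`{p | T is admissible at p}` is `ℚ`-semialgebraic.**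
[cite: BochnakCosteRoy1998, Prop. 2.2.4] -/
theorem isSemialgebraic_setOf_adm [Finite K] (T : SoloInformedPTerm K d) :
    IsSemialgebraic ℚ {p : K → ℝ | T.SoloInformedAdm p} :=
  soloInformed_isSemialgebraic_setOf_and T.isSemialgebraic_setOf_functional
    T.isSemialgebraic_setOf_bounded

/-- `{p | T.fibre p = T'.fibre p}` is `ℚ`-semialgebraic. [cite: BochnakCosteRoy1998, Prop. 2.2.4] -/
theorem isSemialgebraic_setOf_fibre_eq [Finite K] (T T' : SoloInformedPTerm K d) :
    IsSemialgebraic ℚ {p : K → ℝ | T.fibre p = T'.fibre p} := by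
  have hset : {p : K → ℝ | T.fibre p = T'.fibre p} = {p | ∀ x, x ∈ T.fibre p ↔ x ∈ T'.fibre p} := by
    ext p
    exact Set.ext_iff
  rw [hset]
  exact soloInformed_isSemialgebraic_setOf_forall_fibre (T := {w | w ∈ T.S ↔ w ∈ T'.S})
    (soloInformed_isSemialgebraic_setOf_iff T.hS T'.hS) fun p x => Iff.rfl

/-! ### The additivity clause of move (1b) -/

/-- The graph-additivity clause `g = g₁ + g₂ on the fibre of T`, in block form.
[cite: KontsevichZagier2001, §1.2 rule (1)] -/
def SoloInformedAddClause (T T₁ T₂ : SoloInformedPTerm K d) (p : K → ℝ) : Prop :=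
  ∀ (x : Fin d → ℝ) (w : Fin 3 → ℝ), x ∈ T.fibre p → Fin.snoc x (w 0) ∈ T.gfibre p →
    Fin.snoc x (w 1) ∈ T₁.gfibre p → Fin.snoc x (w 2) ∈ T₂.gfibre p → w 0 = w 1 + w 2

/-- **The additivity clause is `ℚ`-semialgebraic in the parameter.**
[cite: BochnakCosteRoy1998, Prop. 2.2.4] -/
theorem isSemialgebraic_setOf_addClause [Finite K] (T T₁ T₂ : SoloInformedPTerm K d) :
    IsSemialgebraic ℚ {p : K → ℝ | SoloInformedAddClause T T₁ T₂ p} := by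
  have hC : IsSemialgebraic ℚ {u : (K ⊕ Fin d) ⊕ Fin 3 → ℝ | u ∘ Sum.inl ∈ T.S →
      u ∘ soloSnocIdx K d 3 0 ∈ T.G → u ∘ soloSnocIdx K d 3 1 ∈ T₁.G →
        u ∘ soloSnocIdx K d 3 2 ∈ T₂.G → u (Sum.inr 0) = u (Sum.inr 1) + u (Sum.inr 2)} :=
    soloInformed_isSemialgebraic_setOf_imp (T.hS.preimage_comp _)
      (soloInformed_isSemialgebraic_setOf_imp (T.hG.preimage_comp _)
        (soloInformed_isSemialgebraic_setOf_imp (T₁.hG.preimage_comp _)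
          (soloInformed_isSemialgebraic_setOf_imp (T₂.hG.preimage_comp _)
            (soloInformed_isSemialgebraic_setOf_coord_eq_add _ _ _))))
  refine soloInformed_isSemialgebraic_setOf_forall_fibre
    (soloInformed_isSemialgebraic_setOf_forall_block hC fun _ => Iff.rfl) fun p x => ?_
  simp only [mem_setOf_eq, Sum.elim_comp_inl, comp_snocIdx_mem_iff, Sum.elim_inr, mem_fibre]

/-- Semantics of the additivity clause: graph values add on the common fibre.
[cite: KontsevichZagier2001, §1.2 rule (1)] -/
theorem gval_eq_add_of_addClause {T T₁ T₂ : SoloInformedPTerm K d} {p : K → ℝ}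
    (h : SoloInformedAddClause T T₁ T₂ p) (hT : T.SoloInformedFunctional p)
    (hT₁ : T₁.SoloInformedFunctional p) (hT₂ : T₂.SoloInformedFunctional p) {x : Fin d → ℝ}
    (hx : x ∈ T.fibre p) (hx₁ : x ∈ T₁.fibre p) (hx₂ : x ∈ T₂.fibre p) :
    T.gval p x = T₁.gval p x + T₂.gval p x := by
  have := h x ![T.gval p x, T₁.gval p x, T₂.gval p x] hx
    (by simpa using snoc_gval_mem hT hx) (by simpa using snoc_gval_mem hT₁ hx₁)
    (by simpa using snoc_gval_mem hT₂ hx₂)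
  simpa using this

/-- The additivity clause holds when the three graphs over the fibre of `T` are graphs of
functions `g = g₁ + g₂`. [cite: KontsevichZagier2001, §1.2 rule (1)] -/
theorem addClause_of_graphs {T T₁ T₂ : SoloInformedPTerm K d} {p : K → ℝ}
    {g g₁ g₂ : (Fin d → ℝ) → ℝ} (hg : ∀ x ∈ T.fibre p, ∀ t, Fin.snoc x t ∈ T.gfibre p ↔ t = g x)
    (hg₁ : ∀ x ∈ T.fibre p, ∀ t, Fin.snoc x t ∈ T₁.gfibre p ↔ t = g₁ x)
    (hg₂ : ∀ x ∈ T.fibre p, ∀ t, Fin.snoc x t ∈ T₂.gfibre p ↔ t = g₂ x)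
    (hadd : ∀ x ∈ T.fibre p, g x = g₁ x + g₂ x) : SoloInformedAddClause T T₁ T₂ p := by
  intro x w hx h0 h1 h2
  rw [(hg x hx _).1 h0, (hg₁ x hx _).1 h1, (hg₂ x hx _).1 h2]
  exact hadd x hx

end SoloInformedPTerm

end Summit.KontsevichZagierPeriods.KontsevichZagierPeriods.Theorems
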